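import Literature.NumberTheory.Rogawski1990.LocalStableClassesNonsplitTypeOneCount
import Literature.LinearAlgebra.Matrix.CyclicVectorCompanionMatrix
import Literature.LinearAlgebra.Matrix.NonderogatoryCommutantBaseChange
import HarnessLib

/-!
# The type (1) local class set from the CHARACTERISTIC POLYNOMIAL: three distinct norm-one roots in `E_v` give an eigenframe, hence four classes
# (Rogawski 1990, §3.5 Prop. 3.5.2 (c) p. 29, §3.6 p. 31; Horn–Johnson 3.3.P12)

Topic `NumberTheory/Rogawski1990`; namespace `Literature.NumberTheory.Rogawski1990`.  THEOREMS ONLY (no definition, no named fact, no instance, no notation,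
no `sorry`).  Cell `pub/hodgecm-mathlib`, programme P3a, road «D-N7-inert», brick (L4a) «LOCAL CLASS SET», TYPE (1): the CONSUMER FORM of ★
`LocalStableClassesNonsplitTypeOneCount` (`ncard_conjClassesIn_eq_four`, which takes an eigenframe `γ P = P · diag(u)` as data) — readers of the (L3) count
and of the norm-fibre∕junction files hold a `G`-regular element through its CHARACTERISTIC POLYNOMIAL `∏ (X − uᵢ)` with three distinct norm-one roots in
`E_v`, and this file supplies the frame.  HC_CM is proved only modulo the printed citations until rung 0 closes; unconditional linear algebra.

* §1 (any field `K`, `Fin m`) **`exists_eigenframe_of_charpoly_eq_prod`**: `charpoly γ = ∏ᵢ (X − C uᵢ)` with `u` injective ⟹ `∃ P ∈ GL_m(K), γ P = P · diag(u)` —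
  `γ` and `diag(u)` are non-derogatory with the same characteristic polynomial (★ `minpoly_eq_charpoly_of_charpoly_separable`,
  `Polynomial.separable_prod_X_sub_C_iff`), hence similar (★ `exists_conj_eq_of_minpoly_eq_charpoly`, [HornJohnson2013, 3.3.P12]).
* §2 (non-split `v`) **`ncard_conjClassesIn_eq_four_of_charpoly`**, `finite_conjClassesIn_of_charpoly`: for `γ ∈ U(H)(F_v)` with `charpoly γ = ∏ (X − uᵢ)`,
  `u` injective, `σ(uᵢ) uᵢ = 1`, the local stable class of `γ` holds EXACTLY FOUR `U(H)(F_v)`-classes ([Rogawski1990, Prop. 3.5.2 (c)], `r = 3`).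

## References
* [Rogawski1990] J. D. Rogawski, *Automorphic Representations of Unitary Groups in Three Variables*, Ann. of Math. Stud. 123 (1990), §3.5 Prop. 3.5.2 (c)
  p. 29, §3.6 p. 31.
* [HornJohnson2013] R. A. Horn, C. R. Johnson, *Matrix Analysis* (2nd ed., 2013), 3.3.P12, Thm 3.3.15.
-/

set_option autoImplicit false

noncomputable section

open Matrix Polynomial NumberField IsDedekindDomain
open scoped MatrixGroups

namespace Literature.NumberTheory.Rogawski1990

open Literature.NumberTheory.Automorphic Literature.NumberTheory.Automorphic.UnitaryGroup
open Literature.AlgebraicGeometry.ShimuraVarieties (unitaryGroup)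

/-! ## §1 Distinct eigenvalues give an eigenframe in the prescribed order -/

section Frame

variable {K : Type*} [Field K] {m : ℕ}

/-- **An eigenframe from the characteristic polynomial**: if `charpoly γ = ∏ᵢ (X − C uᵢ)` with `u : Fin m → K` injective, then `γ P = P · diag(u)` for some
`P ∈ GL_m(K)` — `γ` and `diag(u)` have the same SEPARABLE characteristic polynomial, so both are non-derogatory and they are similar.
[cite: HornJohnson2013, 3.3.P12] [cite: Rogawski1990, §3.6 p. 31] -/
theorem exists_eigenframe_of_charpoly_eq_prod (γ : GL (Fin m) K) (u : Fin m → K) (hu : Function.Injective u)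
    (h : γ.val.charpoly = ∏ i, (X - C (u i))) : ∃ P : GL (Fin m) K, γ.val * P.val = P.val * diagonal u := by
  have hsep : γ.val.charpoly.Separable := by
    rw [h]
    exact separable_prod_X_sub_C_iff.2 hu
  have hD : (diagonal u).charpoly = γ.val.charpoly := by rw [charpoly_diagonal, h]
  obtain ⟨S, hS, hSe⟩ := Literature.LinearAlgebra.Matrix.exists_conj_eq_of_minpoly_eq_charpoly γ.val (diagonal u)
    (Literature.LinearAlgebra.Matrix.minpoly_eq_charpoly_of_charpoly_separable _ hsep)
    (Literature.LinearAlgebra.Matrix.minpoly_eq_charpoly_of_charpoly_separable _ (hD ▸ hsep)) hD.symm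
  refine ⟨Matrix.GeneralLinearGroup.mkOfDetNeZero S hS.ne_zero, ?_⟩
  show γ.val * S = S * diagonal u
  rw [hSe, ← Matrix.mul_assoc, ← Matrix.mul_assoc, Matrix.mul_nonsing_inv S hS, Matrix.one_mul]

end Frame

/-! ## §2 The type (1) count from the characteristic polynomial -/

section Local

variable {F : Type} (E : Type) [Field F] [NumberField F] [Field E] [NumberField E] [Algebra F E]
  [Algebra.IsQuadraticExtension F E] (v : HeightOneSpectrum (𝓞 F)) (c : E ≃ₐ[F] E) {δ : E} (hcδ : c δ = -δ) (hδ : δ ≠ 0)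

include hcδ hδ in
/-- **FOUR CLASSES FROM THE CHARACTERISTIC POLYNOMIAL (type (1), non-split `v`).**  For `H ∈ M₃(E_v)` hermitian with unit determinant and `γ ∈ U(H)(F_v)`
whose characteristic polynomial is `∏ᵢ (X − uᵢ)` with `u₀, u₁, u₂ ∈ E_v` DISTINCT and of NORM ONE (`σ(uᵢ) uᵢ = 1`; the torus `Z(γ) ≅ (E¹_w)³` of [§3.6] type
(1)): the `U(H)(F_v)`-classes inside the local stable class of `γ` number exactly `4 = 2^{3−1}` ([Prop. 3.5.2 (c)]; §1 eigenframe + ★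
`ncard_conjClassesIn_eq_four`). [cite: Rogawski1990, §3.5 Prop. 3.5.2 (c) p. 29; §3.6 p. 31] [cite: HornJohnson2013, 3.3.P12] -/
theorem ncard_conjClassesIn_eq_four_of_charpoly (w : PlacesOver E v) (hw : c • w.1 = w.1)
    {H : Matrix (Fin 3) (Fin 3) (LocalRing E v)} (hH : (H.map (conjLocal E c v))ᵀ = H) (hHd : IsUnit H.det)
    {γ : GL (Fin 3) (LocalRing E v)} (hγ : γ ∈ unitaryGroup (conjLocal E c v) H) (u : Fin 3 → LocalRing E v)
    (hu : Function.Injective u) (hu1 : ∀ i, conjLocal E c v (u i) * u i = 1) (hchar : γ.val.charpoly = ∏ i, (X - C (u i))) :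
    (conjClassesIn (conjLocal E c v) H ⟨γ, hγ⟩).ncard = 4 := by
  letI : Field (LocalRing E v) :=
    (Liu2021.LemD1IndexedNonVacuityNonsplitPlace.isField_localRing_of_nonsplit E v c hcδ hδ w hw).toField
  obtain ⟨P, hP⟩ := exists_eigenframe_of_charpoly_eq_prod γ u hu hchar
  exact ncard_conjClassesIn_eq_four E v c hcδ hδ w hw hH hHd hγ hP hu hu1

include hcδ hδ in
/-- The local stable class of such a `γ` is a finite union of (four) conjugacy classes. [cite: Rogawski1990, §3.5 Prop. 3.5.2 (c) p. 29] -/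
theorem finite_conjClassesIn_of_charpoly (w : PlacesOver E v) (hw : c • w.1 = w.1)
    {H : Matrix (Fin 3) (Fin 3) (LocalRing E v)} (hH : (H.map (conjLocal E c v))ᵀ = H) (hHd : IsUnit H.det)
    {γ : GL (Fin 3) (LocalRing E v)} (hγ : γ ∈ unitaryGroup (conjLocal E c v) H) (u : Fin 3 → LocalRing E v)
    (hu : Function.Injective u) (hu1 : ∀ i, conjLocal E c v (u i) * u i = 1) (hchar : γ.val.charpoly = ∏ i, (X - C (u i))) :
    (conjClassesIn (conjLocal E c v) H ⟨γ, hγ⟩).Finite :=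
  Set.finite_of_ncard_ne_zero (by rw [ncard_conjClassesIn_eq_four_of_charpoly E v c hcδ hδ w hw hH hHd hγ u hu hu1 hchar]; norm_num)

include hcδ hδ in
/-- **Every sum-zero sign vector is realised, from the characteristic polynomial** (type (1), non-split `v`): with the eigenframe of §1 the realisation
★ `exists_conj_mem_forall_normTest_iff` applies; stated with the frame `P` exposed as an output. [cite: Rogawski1990, §3.5 Prop. 3.5.2 (a)(c) p. 29] -/
theorem exists_eigenframe_and_forall_exists_conj_mem_of_charpoly (w : PlacesOver E v) (hw : c • w.1 = w.1)
    {H : Matrix (Fin 3) (Fin 3) (LocalRing E v)} (hH : (H.map (conjLocal E c v))ᵀ = H) (hHd : IsUnit H.det)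
    {γ : GL (Fin 3) (LocalRing E v)} (hγ : γ ∈ unitaryGroup (conjLocal E c v) H) (u : Fin 3 → LocalRing E v)
    (hu : Function.Injective u) (hu1 : ∀ i, conjLocal E c v (u i) * u i = 1) (hchar : γ.val.charpoly = ∏ i, (X - C (u i))) :
    ∃ P : GL (Fin 3) (LocalRing E v), γ.val * P.val = P.val * diagonal u ∧
      ∀ ε : Fin 3 → ZMod 2, ∑ i, ε i = 0 → ∃ g : GL (Fin 3) (LocalRing E v), g * γ * g⁻¹ ∈ unitaryGroup (conjLocal E c v) H ∧
        ∀ i, ((∃ z : LocalRing E v, IsUnit z ∧ twistGram (conjLocal E c v) H (g.val * P.val) i i =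
            conjLocal E c v z * z * twistGram (conjLocal E c v) H P.val i i) ↔ ε i = 0) := by
  letI : Field (LocalRing E v) :=
    (Liu2021.LemD1IndexedNonVacuityNonsplitPlace.isField_localRing_of_nonsplit E v c hcδ hδ w hw).toField
  obtain ⟨P, hP⟩ := exists_eigenframe_of_charpoly_eq_prod γ u hu hchar
  exact ⟨P, hP, fun ε hε => exists_conj_mem_forall_normTest_iff E v c hcδ hδ w hw hH hHd hγ hP hu hu1 ε hε⟩

end Local

end Literature.NumberTheory.Rogawski1990

end
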